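import Literature.NumberTheory.Automorphic.UnitaryGroupArthurTruncatedKernel
import Literature.NumberTheory.Automorphic.UnitaryGroupOfFormAdelicTopology
import Literature.NumberTheory.Automorphic.AdelicGroupDataGLnProofs
import HarnessLib

/-!
# «The sums over `γ` are finite»: `U(J_N)(F)` is discrete in `U(J_N)(𝔸_F)` and the kernels
# `K(x, y) = Σ_{γ ∈ G(F)} f(x⁻¹ γ y)`, `Σ_{β ∈ B(F)} f(x⁻¹ β z)` of a compactly supported `f` are finite sums
(Rogawski, *Automorphic Representations of Unitary Groups in Three Variables* (1990), §2.2, p. 13: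
«The sums over `δ` and `γ` in the definition of `k^T(x)` are finite»; Gelbart, *Automorphic Forms on
Adele Groups* (1975), (9.20); Borel, *Some finiteness properties of adele groups over number fields*
(1963), §5)

Topic `NumberTheory/Automorphic`; namespace `Literature.NumberTheory.Automorphic.UnitaryGroup`. THEOREMS
ONLY over accepted tree modules: no definition, no named fact, no `sorry`, no instance, no notation.
Companion of `UnitaryGroupTruncationFiniteSum` (the `δ`-sum); together they make every sum in the
definition of Arthur's `k^T` for `U(3)` (★ `UnitaryGroupArthurTruncatedKernel`) an honest finite sum.

* `isDiscreteRational_quasiSplit` — **`G(F) = U(J_N)(F)` is DISCRETE in `G(𝔸_F)`** for every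
  CM-like pair `(F, E, c)` and every `N`: `G(F) ↪ GL_N(E)`, which is discrete in `GL_N(𝔸_E)`
  (★ `gl_isDiscreteRational_holds`, Borel 1963 §5), along the continuous injective inclusion
  `U(J_N)(𝔸_F) ≤ GL_N(𝔸_E)` (Mathlib `DiscreteTopology.of_continuous_injective`). (The CM-pair case
  is ★ `adelicGroupData_isDiscreteRational`; here no CM hypothesis.)
* `finite_setOf_mem_arithmeticSubgroup_of_isCompact` — for compact `C ⊆ G(𝔸_F)` and `x, y`, the set
  `{γ ∈ G(F) : x⁻¹ γ y ∈ C}` is finite (a discrete subgroup is closed; closed embeddings pull compact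
  sets back to compact sets; compact discrete sets are finite).
* `summable_kernel_of_hasCompactSupport`, `kernel_eq_sum` — for `f` with compact support,
  `γ ↦ f(x⁻¹ γ y)` has finite support on `G(F)`, so ★ `kernel f x y = Σ_{γ ∈ S} f(x⁻¹ γ y)` is a
  genuine finite sum (never the junk `0` of a non-summable `tsum`) [Gelbart1975 (9.20): «the sum is
  actually finite»; Rogawski1990 §2.2]; likewise `summable_borelSum_of_hasCompactSupport`,
  `borelSum_eq_sum` for the Borel sum over `B(F)` — the summability inputs `hs` of the accepted
  `𝔬`-expansion letter (`UnitaryGroupArthurKernelClassExpansion`) discharged.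

## References

* J. D. Rogawski, *Automorphic Representations of Unitary Groups in Three Variables*, Annals of
  Mathematics Studies 123 (1990), §2.2 (p. 13) [Rogawski1990].
* S. Gelbart, *Automorphic Forms on Adele Groups*, Annals of Mathematics Studies 83 (1975), §9,
  (9.20) [Gelbart1975].
* A. Borel, *Some finiteness properties of adele groups over number fields*, Publ. Math. IHÉS 16
  (1963), §5 [Borel1963].
-/

noncomputable section

open MeasureTheory NumberField IsDedekindDomain Topology Set
open scoped NNReal MatrixGroups

namespace Literature.NumberTheory.Automorphic

namespace UnitaryGroup

variable {F E : Type} [Field F] [NumberField F] [Field E] [NumberField E] [Algebra F E]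
  {c : E ≃ₐ[F] E} {N : ℕ}

/-- **`U(J_N)(F)` is discrete in `U(J_N)(𝔸_F)`** (`IsDiscreteRational` of the quasi-split datum, for
every `(F, E, c, N)`): the inclusion `U(J_N)(𝔸_F) ≤ GL_N(𝔸_E)` restricts to a continuous injection of
`G(F)` into the discrete `GL_N(E) ≤ GL_N(𝔸_E)` (★ `gl_isDiscreteRational_holds`; Borel (1963), §5).
[cite: Borel1963, §5] -/
theorem isDiscreteRational_quasiSplit : (quasiSplit F E c N).IsDiscreteRational := by
  haveI : DiscreteTopology ↥(AdelicGroupData.gl N E).arithmeticSubgroup := gl_isDiscreteRational_holds N E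
  change DiscreteTopology ↥(quasiSplit F E c N).arithmeticSubgroup
  -- the map `γ ↦ adelicVal γ ∈ GL_N(E) ≤ GL_N(𝔸_E)`
  have hmem : ∀ γ : (quasiSplit F E c N).arithmeticSubgroup,
      adelicVal F E c N _ (γ : (quasiSplit F E c N).Adelic) ∈ (AdelicGroupData.gl N E).arithmeticSubgroup := by
    rintro ⟨g, ⟨γ, rfl⟩⟩
    exact ⟨(γ.1 : GL (Fin N) E), rfl⟩
  let ι : (quasiSplit F E c N).arithmeticSubgroup → (AdelicGroupData.gl N E).arithmeticSubgroup :=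
    fun γ => ⟨adelicVal F E c N _ (γ : (quasiSplit F E c N).Adelic), hmem γ⟩
  have hc : Continuous ι :=
    ((continuous_subtype_val).comp continuous_subtype_val).subtype_mk _
  have hinj : Function.Injective ι := by
    intro a b h
    have h' := congrArg (fun z : (AdelicGroupData.gl N E).arithmeticSubgroup => z.1) h
    exact Subtype.ext (adelicVal_injective F E c N _ h')
  exact DiscreteTopology.of_continuous_injective hc hinj

/-- **Only finitely many `γ ∈ G(F)` have `x⁻¹ γ y` in a given compact set** `C ⊆ G(𝔸_F)`: `G(F)` is
a discrete (hence closed) subgroup, so `γ ↦ γ` is a closed embedding pulling the compact set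
`x C y⁻¹` back to a compact, hence finite, subset of the discrete `G(F)` (Gelbart (1975), (9.20): «the
sum is actually finite»). [cite: Gelbart1975, (9.20)] -/
theorem finite_setOf_mem_arithmeticSubgroup_of_isCompact {C : Set (quasiSplit F E c N).Adelic}
    (hC : IsCompact C) (x y : (quasiSplit F E c N).Adelic) :
    {γ : (quasiSplit F E c N).arithmeticSubgroup |
      x⁻¹ * (γ : (quasiSplit F E c N).Adelic) * y ∈ C}.Finite := by
  haveI : DiscreteTopology ↥(quasiSplit F E c N).arithmeticSubgroup := isDiscreteRational_quasiSplit
  haveI : T2Space (quasiSplit F E c N).Adelic :=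
    inferInstanceAs (T2Space (adelic F E c N ((StdForm.antidiagonal N).over E)))
  have hcl : IsClosed (((quasiSplit F E c N).arithmeticSubgroup : Set (quasiSplit F E c N).Adelic)) :=
    Subgroup.isClosed_of_discrete
  -- `{g | x⁻¹ g y ∈ C}` is compact: the image of `C` under the homeomorphism `g ↦ x g y⁻¹`
  let e : (quasiSplit F E c N).Adelic ≃ₜ (quasiSplit F E c N).Adelic :=
    (Homeomorph.mulLeft x⁻¹).trans (Homeomorph.mulRight y)
  have he : ∀ g, e g = x⁻¹ * g * y := fun g => rfl
  have hK : IsCompact ((fun g : (quasiSplit F E c N).Adelic => x⁻¹ * g * y) ⁻¹' C) := by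
    have : (fun g : (quasiSplit F E c N).Adelic => x⁻¹ * g * y) = e := funext fun g => (he g).symm
    rw [this]
    exact e.isCompact_preimage.2 hC
  have hK' : IsCompact ((Subtype.val : (quasiSplit F E c N).arithmeticSubgroup → (quasiSplit F E c N).Adelic) ⁻¹'
      ((fun g : (quasiSplit F E c N).Adelic => x⁻¹ * g * y) ⁻¹' C)) :=
    hcl.isClosedEmbedding_subtypeVal.isCompact_preimage hK
  exact hK'.finite_of_discrete

/-- **The kernel sum is finite**: for `f` of compact support, `γ ↦ f(x⁻¹ γ y)` has finite support on
`G(F)`; in particular it is summable and ★ `kernel f x y` is its honest sum (Rogawski (1990), §2.2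
p. 13; Gelbart (1975), (9.20)). [cite: Rogawski1990, §2.2 (p. 13)] -/
theorem finite_support_kernel_term {f : (quasiSplit F E c N).Adelic → ℂ} (hf : HasCompactSupport f)
    (x y : (quasiSplit F E c N).Adelic) :
    (Function.support fun γ : (quasiSplit F E c N).arithmeticSubgroup =>
      f (x⁻¹ * (γ : (quasiSplit F E c N).Adelic) * y)).Finite := by
  refine (finite_setOf_mem_arithmeticSubgroup_of_isCompact hf x y).subset fun γ hγ => ?_
  exact subset_tsupport _ hγ

/-- Summability of the kernel family for compactly supported `f` (the input `hs` of the accepted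
`𝔬`-expansion ★ `kernel_eq_tsum_kernelClass`). [cite: Rogawski1990, §2.2 (p. 13)] -/
theorem summable_kernel_of_hasCompactSupport {f : (quasiSplit F E c N).Adelic → ℂ}
    (hf : HasCompactSupport f) (x y : (quasiSplit F E c N).Adelic) :
    Summable fun γ : (quasiSplit F E c N).arithmeticSubgroup =>
      f (x⁻¹ * (γ : (quasiSplit F E c N).Adelic) * y) :=
  summable_of_hasFiniteSupport (finite_support_kernel_term hf x y)

/-- **`K(x, y) = Σ_{γ ∈ S} f(x⁻¹ γ y)`, a genuine finite sum** over the finite support `S` of the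
family (`f` of compact support). [cite: Rogawski1990, §2.2 (p. 13)] -/
theorem kernel_eq_sum {f : (quasiSplit F E c N).Adelic → ℂ} (hf : HasCompactSupport f)
    (x y : (quasiSplit F E c N).Adelic) :
    kernel f x y = ∑ γ ∈ (finite_support_kernel_term hf x y).toFinset,
      f (x⁻¹ * (γ : (quasiSplit F E c N).Adelic) * y) := by
  rw [kernel_def]
  exact tsum_eq_sum fun γ hγ => by
    by_contra h
    exact hγ ((finite_support_kernel_term hf x y).mem_toFinset.2 h)

/-- **The Borel sum is finite**: for `f` of compact support, `β ↦ f(x⁻¹ β z)` has finite support on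
`B(F)` (a subgroup of the discrete `G(F)`). [cite: Rogawski1990, §2.2 (p. 13)] -/
theorem finite_support_borelSum_term {f : (quasiSplit F E c N).Adelic → ℂ} (hf : HasCompactSupport f)
    (x z : (quasiSplit F E c N).Adelic) :
    (Function.support fun β : arithmeticBorel F E c N =>
      f (x⁻¹ * (((β : (quasiSplit F E c N).arithmeticSubgroup)) : (quasiSplit F E c N).Adelic) * z)).Finite := by
  have h := (finite_support_kernel_term hf x z).preimage
    (Subtype.val_injective.injOn (s := Subtype.val ⁻¹' _) : Set.InjOn
      (Subtype.val : arithmeticBorel F E c N → (quasiSplit F E c N).arithmeticSubgroup) _)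
  exact h

/-- Summability of the Borel-sum family for compactly supported `f` (the input `hs` of the accepted
★ `borelSum_eq_sum_borelSumClass`). [cite: Rogawski1990, §2.2 (p. 13)] -/
theorem summable_borelSum_of_hasCompactSupport {f : (quasiSplit F E c N).Adelic → ℂ}
    (hf : HasCompactSupport f) (x z : (quasiSplit F E c N).Adelic) :
    Summable fun β : arithmeticBorel F E c N =>
      f (x⁻¹ * (((β : (quasiSplit F E c N).arithmeticSubgroup)) : (quasiSplit F E c N).Adelic) * z) :=
  summable_of_hasFiniteSupport (finite_support_borelSum_term hf x z)

/-- **`Σ_{β ∈ B(F)} f(x⁻¹ β z) = Σ_{β ∈ S} f(x⁻¹ β z)`, a genuine finite sum** (`f` of compact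
support). [cite: Rogawski1990, §2.2 (p. 13)] -/
theorem borelSum_eq_sum {f : (quasiSplit F E c N).Adelic → ℂ} (hf : HasCompactSupport f)
    (x z : (quasiSplit F E c N).Adelic) :
    borelSum f x z = ∑ β ∈ (finite_support_borelSum_term hf x z).toFinset,
      f (x⁻¹ * (((β : (quasiSplit F E c N).arithmeticSubgroup)) : (quasiSplit F E c N).Adelic) * z) := by
  rw [borelSum_def]
  exact tsum_eq_sum fun β hβ => by
    by_contra h
    exact hβ ((finite_support_borelSum_term hf x z).mem_toFinset.2 h)

end UnitaryGroup

end Literature.NumberTheory.Automorphic
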